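import Summits.CriticalPhenomena.PercolationContinuityZ3.Theorems.Transplant.FKConnectivityAllQWheelRimNegCorr
import Summits.CriticalPhenomena.PercolationContinuityZ3.Theorems.Transplant.FKConnectivityAllQHubCovEquiv
import Summits.CriticalPhenomena.PercolationContinuityZ3.Theorems.Transplant.FKConnectivityAllQDegThree
import HarnessLib

/-!
# Connectivity correlation inequalities for `φ_{w,q}`, every `q > 0` — WHEELS (apex over a cycle), file 10:
# COROLLARIES — pair slices `NegCorrPairSupp` for spoke/spoke and rim/rim pairs, and the HUB COVARIANCE BOUND at the apex

Support file (`--supports stmt-CriticalPhenomena-4575`), FK sub-lane `prim-bschramm-fk-3` (gen 8) of the post-continuity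
programme; builds on p205010 (kernel theorem, internal audit signed; external expert review pending).  No definitions, no named
facts, no sorries; standard axioms.

Packaging of THEOREM W (`wheel_negCorr_spokes`, file `…WheelNegCorr`) and THEOREM W′ (`wheel_negCorr_rims`, file
`…WheelRimNegCorr`) in the vocabulary of the programme:
* `wheel_negCorr_spokes_of_ne` / `wheel_negCorr_rims_of_ne` — the two pairs indexed by any `y ≠ z` below `n` (instead of `y`, `y + d`);
* `negCorrPairSupp_wheel_spokes` / `negCorrPairSupp_wheel_rims` — the pair slices `NegCorrPairSupp ↑(wheelPairs x v n) q e f` of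
  edge-negative association (file `…DegThree`) for every two spokes and every two rim pairs, `0 < q ≤ 1`;
* `hubCovBoundUnder_wheel` — the HUB COVARIANCE BOUND `(1 − q)·Cov_φ(1{x ↔ v_y}, 1{x ↔ v_z}) ≤ φ(x ↮ v_y ↔ v_z)` (statement
  `HubCovBoundUnder`, node `HubCovBoundFKLtOne` of file `…HubCov`) at the apex `x` of every weighted apex-over-cycle graph whose
  weight vanishes on the two spokes `x v_y`, `x v_z`, for every `0 < q ≤ 1` (via `hubCovBoundUnder_of_negCorr_half`): the first
  hubs of unbounded degree in graphs with a `K₄` minor for which the node is settled (`q < 1`).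
Together with fk-1 g7's `wheel_negCorr_at_rim` (the three pairs at a rim vertex) the only pair type of a wheel not covered is a rim
pair versus a NON-incident spoke (bschramm/prim-bschramm-fk-3/WHEELS-HUB-NC.md §8).
[cite: Grimmett2006, §3.9 eq. (3.94), Conj. (3.96) (pp. 63–66)] [cite: Wagner2006, Conj. 5.3, Thm. 5.8 (p. 13)]
-/

noncomputable section

namespace Summit.CriticalPhenomena.PercolationContinuityZ3.Theorems

namespace FK

namespace Wheel

open MeasureTheory Set Literature.Probability.LatticeModels Literature.Probability.Percolation
open scoped Classical

variable {V : Type*} [Fintype V]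
variable {x : V} {v : ℕ → V} {n : ℕ}
variable (hn : 3 ≤ n) (hinj : ∀ j k, j < n → k < n → v j = v k → j = k) (hx : ∀ j, j < n → v j ≠ x)
  (hcard : Fintype.card V = n + 1)
include hn hinj hx hcard

/-! ### The two theorems with the second pair indexed freely -/

/-- **THEOREM W, free indexing**: for `0 < q ≤ 1` and every weight vector supported on the wheel pairs, any two distinct spokes
`x v_y`, `x v_z` (`y ≠ z < n`) are negatively correlated under `φ_{w,q}`. (transcription of bschramm/prim-bschramm-fk-3/WHEELS-HUB-NC.md §0)
[cite: Grimmett2006, §3.9 eq. (3.94) (p. 63)] -/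
theorem wheel_negCorr_spokes_of_ne {q : ℝ} (hq0 : 0 < q) (hq1 : q ≤ 1) (w : Sym2 V → unitInterval)
    (hsupp : ∀ e, e ∉ wheelPairs x v n → w e = 0) {y z : ℕ} (hy : y < n) (hz : z < n) (hyz : y ≠ z) :
    (rcMeasureW w q ∅).real ({ω : BondConfig V | spokePair x v n y ∈ ω} ∩ {ω | spokePair x v n z ∈ ω}) ≤
      (rcMeasureW w q ∅).real {ω | spokePair x v n y ∈ ω} * (rcMeasureW w q ∅).real {ω | spokePair x v n z ∈ ω} := by
  rcases lt_or_gt_of_ne hyz with h | h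
  · have key := wheel_negCorr_spokes hn hinj hx hcard hq0 hq1 w hsupp (y := y) (d := z - y) hy (by omega) (by omega)
    rwa [show y + (z - y) = z by omega] at key
  · have key := wheel_negCorr_spokes hn hinj hx hcard hq0 hq1 w hsupp (y := z) (d := y - z) hz (by omega) (by omega)
    rw [show z + (y - z) = y by omega] at key
    rwa [Set.inter_comm, mul_comm]

/-- **THEOREM W′, free indexing**: for `0 < q ≤ 1` and every weight vector supported on the wheel pairs, any two distinct rim
pairs `v_y v_{y+1}`, `v_z v_{z+1}` (`y ≠ z < n`) are negatively correlated under `φ_{w,q}`. (transcription of bschramm/prim-bschramm-fk-3/WHEELS-HUB-NC.md §7)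
[cite: Grimmett2006, §3.9 eq. (3.94) (p. 63)] -/
theorem wheel_negCorr_rims_of_ne {q : ℝ} (hq0 : 0 < q) (hq1 : q ≤ 1) (w : Sym2 V → unitInterval)
    (hsupp : ∀ e, e ∉ wheelPairs x v n → w e = 0) {y z : ℕ} (hy : y < n) (hz : z < n) (hyz : y ≠ z) :
    (rcMeasureW w q ∅).real ({ω : BondConfig V | rimPair v n y ∈ ω} ∩ {ω | rimPair v n z ∈ ω}) ≤
      (rcMeasureW w q ∅).real {ω | rimPair v n y ∈ ω} * (rcMeasureW w q ∅).real {ω | rimPair v n z ∈ ω} := by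
  rcases lt_or_gt_of_ne hyz with h | h
  · have key := wheel_negCorr_rims hn hinj hx hcard hq0 hq1 w hsupp (y := y) (d := z - y) hy (by omega) (by omega)
    rwa [show y + (z - y) = z by omega] at key
  · have key := wheel_negCorr_rims hn hinj hx hcard hq0 hq1 w hsupp (y := z) (d := y - z) hz (by omega) (by omega)
    rw [show z + (y - z) = y by omega] at key
    rwa [Set.inter_comm, mul_comm]

/-! ### Pair slices of edge-negative association on the wheel support -/

omit [Fintype V] hn hinj hx hcard in
/-- Support hypotheses: `{g | w g ≠ 0} ⊆ wheelPairs` in the real-valued form of `NegCorrPairSupp` gives the `unitInterval` form used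
by the wheel theorems. [folklore] -/
theorem supp_of_real_supp (w : Sym2 V → unitInterval) (hw : ∀ g, ((w g : unitInterval) : ℝ) ≠ 0 → g ∈ (↑(wheelPairs x v n) : Set (Sym2 V))) :
    ∀ e, e ∉ wheelPairs x v n → w e = 0 := by
  intro e he
  by_contra hne
  refine he (Finset.mem_coe.1 (hw e ?_))
  intro h0
  exact hne (Subtype.ext (by simpa using h0))

/-- **Every two spokes of a wheel form a negatively correlated pair under every `φ_{w,q}` supported on the wheel**, `0 < q ≤ 1`
(the pair slice `NegCorrPairSupp` of edge-negative association). (transcription of bschramm/prim-bschramm-fk-3/WHEELS-HUB-NC.md §0)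
[cite: Grimmett2006, §3.9 eq. (3.94) (p. 63)] [cite: Wagner2006, Conj. 5.3 (p. 13)] -/
theorem negCorrPairSupp_wheel_spokes {q : ℝ} (hq0 : 0 < q) (hq1 : q ≤ 1) {y z : ℕ} (hy : y < n) (hz : z < n) (hyz : y ≠ z) :
    NegCorrPairSupp (↑(wheelPairs x v n) : Set (Sym2 V)) q (spokePair x v n y) (spokePair x v n z) :=
  fun w hw => wheel_negCorr_spokes_of_ne hn hinj hx hcard hq0 hq1 w (supp_of_real_supp w hw) hy hz hyz

/-- **Every two rim pairs of a wheel form a negatively correlated pair under every `φ_{w,q}` supported on the wheel**, `0 < q ≤ 1`.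
(transcription of bschramm/prim-bschramm-fk-3/WHEELS-HUB-NC.md §7) [cite: Grimmett2006, §3.9 eq. (3.94) (p. 63)] [cite: Wagner2006, Conj. 5.3 (p. 13)] -/
theorem negCorrPairSupp_wheel_rims {q : ℝ} (hq0 : 0 < q) (hq1 : q ≤ 1) {y z : ℕ} (hy : y < n) (hz : z < n) (hyz : y ≠ z) :
    NegCorrPairSupp (↑(wheelPairs x v n) : Set (Sym2 V)) q (rimPair v n y) (rimPair v n z) :=
  fun w hw => wheel_negCorr_rims_of_ne hn hinj hx hcard hq0 hq1 w (supp_of_real_supp w hw) hy hz hyz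

/-! ### The hub covariance bound at the apex -/

/-- **THE HUB COVARIANCE BOUND AT THE APEX OF EVERY WEIGHTED WHEEL** (`0 < q ≤ 1`): for every weight vector supported on the
wheel pairs and vanishing on the spokes `x v_y`, `x v_z` (`y ≠ z < n`),
`(1 − q)·Cov_{φ_w}(1{x ↔ v_y}, 1{x ↔ v_z}) ≤ φ_w(x ↮ v_y ↔ v_z)` — the node `HubCovBoundUnder` at `(x; v_y, v_z)`.  Proof: negative
correlation of the two spokes in the state `w[x v_y ↦ ½][x v_z ↦ ½]` (THEOREM W) and `hubCovBoundUnder_of_negCorr_half`; `q = 1`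
is `hubCovBoundUnder_of_q_one`. (transcription of bschramm/prim-bschramm-fk-3/WHEELS-HUB-NC.md §0; bschramm/FK-BARRIER.md §12)
[cite: Grimmett2006, §3.9 eq. (3.94), Conj. (3.96) (pp. 63–66)] [cite: Wagner2006, Conj. 5.3 (p. 13)] -/
theorem hubCovBoundUnder_wheel {q : ℝ} (hq0 : 0 < q) (hq1 : q ≤ 1) (w : Sym2 V → unitInterval)
    (hsupp : ∀ e, e ∉ wheelPairs x v n → w e = 0) {y z : ℕ} (hy : y < n) (hz : z < n) (hyz : y ≠ z)
    (h0y : ((w s(x, v y) : unitInterval) : ℝ) = 0) (h0z : ((w s(x, v z) : unitInterval) : ℝ) = 0) :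
    HubCovBoundUnder (rcMeasureW w q ∅) q x (v y) (v z) := by
  rcases eq_or_lt_of_le hq1 with rfl | hq1'
  · exact hubCovBoundUnder_of_q_one _ x (v y) (v z)
  have hvyz : v y ≠ v z := fun h => hyz (hinj y z hy hz h)
  have hsy : spokePair x v n y = s(x, v y) := by unfold spokePair; rw [Nat.mod_eq_of_lt hy]
  have hsz : spokePair x v n z = s(x, v z) := by unfold spokePair; rw [Nat.mod_eq_of_lt hz]
  have hmy : s(x, v y) ∈ wheelPairs x v n := by rw [← hsy, mem_wheelPairs_iff]; exact Or.inl ⟨y, hy, rfl⟩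
  have hmz : s(x, v z) ∈ wheelPairs x v n := by rw [← hsz, mem_wheelPairs_iff]; exact Or.inl ⟨z, hz, rfl⟩
  refine hubCovBoundUnder_of_negCorr_half hq0 hq1' w x (v y) (v z) h0y h0z hvyz ?_
  have hsupp' : ∀ e, e ∉ wheelPairs x v n →
      Function.update (Function.update w s(x, v y) (⟨2⁻¹, by norm_num, by norm_num⟩ : unitInterval)) s(x, v z)
        (⟨2⁻¹, by norm_num, by norm_num⟩ : unitInterval) e = 0 := by
    intro e he
    have hey : e ≠ s(x, v y) := by rintro rfl; exact he hmy
    have hez : e ≠ s(x, v z) := by rintro rfl; exact he hmz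
    rw [Function.update_of_ne hez, Function.update_of_ne hey]
    exact hsupp e he
  have key := wheel_negCorr_spokes_of_ne hn hinj hx hcard hq0 hq1 _ hsupp' hy hz hyz
  rwa [hsy, hsz] at key

end Wheel

end FK

end Summit.CriticalPhenomena.PercolationContinuityZ3.Theorems
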